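import Summits.NavierStokesRegularity.NavierStokesRegularity.Theorems.TypeICertificateLadderTargetStretchingChannelsLongitudinal
import Summits.NavierStokesRegularity.NavierStokesRegularity.Theorems.TypeICertificateLadderTargetStretchingChannelsTwist
import Summits.NavierStokesRegularity.NavierStokesRegularity.Theorems.TypeICertificateLadderTargetFlowwiseDepletionEventualRung
import HarnessLib

/-!
# Crux `Target` = `TypeICertificateLadder.NoTypeIBlowup` (stmt-NavierStokesRegularity-1217), line
# `depletion-ladder`: THE VORTICITY-SIDE CHANNELS OF ENSTROPHY PRODUCTION, III — rungs and Type-I portraits: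
# a Type-I blow-up keeps its LONGITUDINAL palinstrophy fraction `L(t) ≥ C⁻²` and its TWIST fraction
# `τ(t) ≤ 1 − C⁻²` at times accumulating at `T`

`--supports stmt-NavierStokesRegularity-1217` (helper; file 3 of 3, consumer of `…ChannelsLongitudinal` and
`…ChannelsTwist` through the eventual flow-wise rung glue `rung_of_eventualDepletion` of g6). Author: STA lineage
`ns-sta-19551-p1` (g12).

For a classical Leray–Hopf rapidly-decaying-datum solution `u` on `ℝ³ × [0,T)` write `ω = curl u(t)`, `ξ = ω/|ω|`,
`W(t) = ‖∇ω‖₂²`, and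
`L(t) := ‖∂_ξω‖₂²/W = (∫‖Dω ω‖²/‖ω‖²)/W ∈ [0,1]` (LONGITUDINAL palinstrophy fraction: along-line slope of `|ω|` plus
`|ω|²κ²`, file I), `τ(t) := (∫⟪ω, curl ω⟫²/‖ω‖²)/W ∈ [0,1]` (TWIST fraction: the pointwise current-helicity density
`(ξ·curl ω)² = |ω|²(ξ·curl ξ)²`, file II).

* `longitudinal_along_flow`, `transversalCurl_along_flow` — the kinematic bounds of files I/II at every slice of the
  flow (Tao cover ⇒ slice class): `|J(t)| ≤ M·‖ω‖₂·‖∂_ξω‖₂` and `|J(t)| ≤ M·‖ω‖₂·√(W − τW)` for any bound `|u(t)| ≤ M`.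
* `hasSmoothExtensionPast_of_eventually_longitudinalFraction_le` — **LONGITUDINAL RUNG**: eventual rate
  `√(T−t)|u| ≤ C√ν` and `L(t) ≤ η²` on a final interval with `ηC < 1` ⇒ smooth extension past `T`;
  `frequently_longitudinalFraction_gt` — **PORTRAIT**: a Type-I(`C`) singular time forces `L(t) > η²` FREQUENTLY as
  `t ↑ T` for every `η` with `ηC < 1` (`limsup L ≥ C⁻²`): the vortex lines of a Type-I blow-up cannot become straight
  with `|ω|` uniform along them in palinstrophy measure — at rate `C ≤ 2.5` (the tree's reach) at least `16 %` of the
  palinstrophy must stay in `∂_ξ|ω|` and curvature;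
  `hasSmoothExtensionPast_of_isTypeIBlowup_of_longitudinalFraction_tendsto` — the TARGET-SHAPED corollary: a Type-I
  singular solution (ANY rate) whose longitudinal fraction tends to `0` extends past `T`.
* `hasSmoothExtensionPast_of_eventually_twistFraction_ge`, `frequently_twistFraction_lt`,
  `hasSmoothExtensionPast_of_isTypeIBlowup_of_twistFraction_tendsto` — the same for the twist: `τ(t) ≥ 1 − η²`
  eventually with `ηC < 1` ⇒ extension; a Type-I(`C`) singular time forces `τ(t) < 1 − η²` frequently
  (`liminf τ ≤ 1 − C⁻²`); a Type-I singular solution whose palinstrophy becomes fully helical (`τ → 1`) extends.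

Meaning for crux 19551 / the door family: the W3-type doors control the transversal COHERENCE of `ξ` (all of `∇ξ`);
the enstrophy channel sees `∇ξ` only through the curvature `∂_ξξ` (shared by both channels), plus `∂_ξ|ω|` and
`∇_⊥|ω|` — typed here as the statement that the OTHER components (transversal direction gradients with `|ω|` fixed,
and twist) are free. WHAT THIS IS NOT: conditional criteria and necessary conditions; nothing here excludes a
blow-up; nothing on Type II. [folklore]
-/

noncomputable section

open Set Filter Topology MeasureTheory
open scoped RealInnerProductSpace ENNReal NNReal ContDiff
open Literature.Analysis.FluidPDE

namespace Summit.NavierStokesRegularity.NavierStokesRegularity.Theorems.DepletionLadder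

-- the problem directory repeats the summit name (`NavierStokesRegularity/NavierStokesRegularity`)
set_option linter.dupNamespace false

open Summit.NavierStokesRegularity.NavierStokesRegularity.Theorems.RungReynoldsOne

namespace Channels

variable {ν T : ℝ} {u : ℝ → EuclideanSpace ℝ (Fin 3) → EuclideanSpace ℝ (Fin 3)}
  {p : ℝ → EuclideanSpace ℝ (Fin 3) → ℝ}

/-! ## The two channels along a flow -/

/-- **The longitudinal bound along a flow.** For a classical Leray–Hopf rapidly-decaying-datum solution on `[0,T)`,
every `t ∈ [0,T)` and every bound `|u(t,·)| ≤ M`: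
`|∫⟪ω, Du ω⟫| ≤ M · ‖ω(t)‖₂ · (∫‖Dω ω‖²/‖ω‖²)^{1/2}` (slice class from the Tao cover; file I). [folklore] -/
theorem longitudinal_along_flow (hν : 0 < ν) (hT : 0 < T)
    (hsol : IsClassicalNSSolutionOn (Ico 0 T) ν 0 u p) (hLH : IsLerayHopfOn T ν 0 (u 0) u)
    (hdec : HasRapidSpatialDecay (u 0)) :
    ∀ t ∈ Ico 0 T, ∀ M : ℝ, (∀ x, ‖u t x‖ ≤ M) →
      |∫ x, ⟪curl (u t) x, fderiv ℝ (u t) x (curl (u t) x)⟫| ≤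
        M * Real.sqrt (∫ x, ‖curl (u t) x‖ ^ 2) *
          Real.sqrt (∫ x, ‖fderiv ℝ (curl (u t)) x (curl (u t) x)‖ ^ 2 / ‖curl (u t) x‖ ^ 2) := by
  intro t ht M hM
  have ht' : (t + T) / 2 ∈ Ioo 0 T := ⟨by linarith [ht.1], by linarith [ht.2]⟩
  obtain ⟨q, hsolt, hut, -, -⟩ := stub_taoCover hν hT hsol hLH hdec ht'
  have htI : t ∈ Icc 0 ((t + T) / 2) := ⟨ht.1, by linarith [ht.2]⟩
  obtain ⟨B₁, -, hB₁⟩ := exists_forall_norm_fderiv_le_of_hasBoundedSobolevNormsOn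
    (fun s hs => (hsolt.contDiff_velocity hs).of_le (by norm_cast)) hut
  obtain ⟨iZ, iA, -⟩ := slice_integrability hsolt hut htI
  have hv : ContDiff ℝ ∞ (u t) := hsol.contDiff_velocity ht
  exact abs_integral_stretching_le_longitudinal (hv.of_le (by norm_cast)) hM (hB₁ t htI) iZ iA

/-- **The transversal-curl (twist-free) bound along a flow.** Same setting:
`|∫⟪ω, Du ω⟫| ≤ M · ‖ω(t)‖₂ · (‖∇ω(t)‖₂² − ∫⟪ω, curl ω⟫²/‖ω‖²)^{1/2}` (file II and `‖curl ω‖₂ = ‖∇ω‖₂`). [folklore] -/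
theorem transversalCurl_along_flow (hν : 0 < ν) (hT : 0 < T)
    (hsol : IsClassicalNSSolutionOn (Ico 0 T) ν 0 u p) (hLH : IsLerayHopfOn T ν 0 (u 0) u)
    (hdec : HasRapidSpatialDecay (u 0)) :
    ∀ t ∈ Ico 0 T, ∀ M : ℝ, (∀ x, ‖u t x‖ ≤ M) →
      |∫ x, ⟪curl (u t) x, fderiv ℝ (u t) x (curl (u t) x)⟫| ≤
        M * Real.sqrt (∫ x, ‖curl (u t) x‖ ^ 2) *
          Real.sqrt ((∫ x, frobeniusNormSq (fderiv ℝ (curl (u t)) x)) -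
            ∫ x, ⟪curl (u t) x, curl (curl (u t)) x⟫ ^ 2 / ‖curl (u t) x‖ ^ 2) := by
  intro t ht M hM
  have ht' : (t + T) / 2 ∈ Ioo 0 T := ⟨by linarith [ht.1], by linarith [ht.2]⟩
  obtain ⟨q, hsolt, hut, -, -⟩ := stub_taoCover hν hT hsol hLH hdec ht'
  have htI : t ∈ Icc 0 ((t + T) / 2) := ⟨ht.1, by linarith [ht.2]⟩
  obtain ⟨iZ, iA, iJ⟩ := slice_integrability hsolt hut htI
  have hv : ContDiff ℝ ∞ (u t) := hsol.contDiff_velocity ht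
  have hM0 : 0 ≤ M := (norm_nonneg _).trans (hM 0)
  have h := abs_integral_stretching_le_transversalCurl (hv.of_le (by norm_cast)) (hsol.divFree t ht) hM iZ iA iJ
  obtain ⟨-, -, hle⟩ := integral_transversalCurlSq_le (v := u t) (hv.of_le (by norm_cast)) iA
  rw [integral_norm_curl_curl_sq_eq (hv.of_le (by norm_cast)) iZ iA] at hle
  exact h.trans (mul_le_mul_of_nonneg_left (Real.sqrt_le_sqrt hle) (by positivity))

/-! ## The longitudinal rung and its portrait -/

/-- **THE LONGITUDINAL RUNG.** A classical Leray–Hopf rapidly-decaying-datum solution on `[0,T)` with eventual rate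
`√(T−t)|u(t,x)| ≤ C√ν` whose longitudinal palinstrophy fraction satisfies, on a final interval `[t₁,T)`,
`∫‖Dω ω‖²/‖ω‖² ≤ η² ‖∇ω‖₂²` with `0 ≤ η` and `ηC < 1`, extends smoothly past `T`
(`|J| ≤ η M ‖ω‖₂‖∇ω‖₂` on `[t₁,T)` + `rung_of_eventualDepletion`). [folklore] -/
theorem hasSmoothExtensionPast_of_eventually_longitudinalFraction_le {C η t₁ : ℝ} (hν : 0 < ν) (hT : 0 < T)
    (hC : 0 < C) (hη0 : 0 ≤ η) (hηC : η * C < 1) (ht₁ : t₁ ∈ Ico 0 T)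
    (hsol : IsClassicalNSSolutionOn (Ico 0 T) ν 0 u p) (hLH : IsLerayHopfOn T ν 0 (u 0) u)
    (hdec : HasRapidSpatialDecay (u 0))
    (hL : ∀ t ∈ Ico t₁ T,
      ∫ x, ‖fderiv ℝ (curl (u t)) x (curl (u t) x)‖ ^ 2 / ‖curl (u t) x‖ ^ 2 ≤
        η ^ 2 * ∫ x, frobeniusNormSq (fderiv ℝ (curl (u t)) x))
    (hrate : ∀ᶠ t in 𝓝[<] T, ∀ x, Real.sqrt (T - t) * ‖u t x‖ ≤ C * Real.sqrt ν) :
    HasSmoothExtensionPast ν 0 u T := by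
  refine rung_of_eventualDepletion hν hT hη0 hC hηC ht₁ hsol hLH hdec (fun t ht M hM => ?_) hrate
  have ht0 : t ∈ Ico 0 T := ⟨ht₁.1.trans ht.1, ht.2⟩
  have hM0 : 0 ≤ M := (norm_nonneg _).trans (hM 0)
  have h := longitudinal_along_flow hν hT hsol hLH hdec t ht0 M hM
  have hW0 : 0 ≤ ∫ x, frobeniusNormSq (fderiv ℝ (curl (u t)) x) :=
    integral_nonneg fun x => frobeniusNormSq_nonneg _
  have hsq : Real.sqrt (∫ x, ‖fderiv ℝ (curl (u t)) x (curl (u t) x)‖ ^ 2 / ‖curl (u t) x‖ ^ 2) ≤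
      η * Real.sqrt (∫ x, frobeniusNormSq (fderiv ℝ (curl (u t)) x)) := by
    rw [← Real.sqrt_sq hη0, ← Real.sqrt_mul (sq_nonneg _)]
    exact Real.sqrt_le_sqrt (hL t ht)
  calc _ ≤ _ := h
    _ ≤ M * Real.sqrt (∫ x, ‖curl (u t) x‖ ^ 2) *
          (η * Real.sqrt (∫ x, frobeniusNormSq (fderiv ℝ (curl (u t)) x))) :=
        mul_le_mul_of_nonneg_left hsq (by positivity)
    _ = _ := by ring

/-- **PORTRAIT: a Type-I blow-up keeps longitudinal palinstrophy.** If the classical Leray–Hopf rapidly-decaying-datum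
solution has eventual rate `√(T−t)|u| ≤ C√ν` and does NOT extend past `T`, then for every `0 ≤ η` with `ηC < 1`,
FREQUENTLY as `t ↑ T`: `∫‖Dω ω‖²/‖ω‖² > η² ‖∇ω‖₂²` — i.e. `limsup_{t↑T} L(t) ≥ C⁻²`: a fixed fraction of the
palinstrophy stays in the variation of `ω` along its own lines (`∂_ξ|ω|` and curvature `|ω|κ`). [folklore] -/
theorem frequently_longitudinalFraction_gt {C η : ℝ} (hν : 0 < ν) (hT : 0 < T) (hC : 0 < C) (hη0 : 0 ≤ η)
    (hηC : η * C < 1)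
    (hsol : IsClassicalNSSolutionOn (Ico 0 T) ν 0 u p) (hLH : IsLerayHopfOn T ν 0 (u 0) u)
    (hdec : HasRapidSpatialDecay (u 0))
    (hrate : ∀ᶠ t in 𝓝[<] T, ∀ x, Real.sqrt (T - t) * ‖u t x‖ ≤ C * Real.sqrt ν)
    (hsing : ¬ HasSmoothExtensionPast ν 0 u T) :
    ∃ᶠ t in 𝓝[<] T,
      η ^ 2 * ∫ x, frobeniusNormSq (fderiv ℝ (curl (u t)) x) <
        ∫ x, ‖fderiv ℝ (curl (u t)) x (curl (u t) x)‖ ^ 2 / ‖curl (u t) x‖ ^ 2 := by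
  by_contra h
  rw [not_frequently] at h
  obtain ⟨a, haT, hsub⟩ := mem_nhdsLT_iff_exists_Ioo_subset.1 h
  set t₁ : ℝ := (max a 0 + T) / 2 with ht₁def
  have hm : max a 0 < T := max_lt haT hT
  have ht₁ : t₁ ∈ Ico 0 T := by
    have := le_max_right a 0; rw [ht₁def]; constructor <;> linarith
  have hat₁ : a < t₁ := by
    have := le_max_left a 0; rw [ht₁def]; linarith
  have hL : ∀ t ∈ Ico t₁ T,
      ∫ x, ‖fderiv ℝ (curl (u t)) x (curl (u t) x)‖ ^ 2 / ‖curl (u t) x‖ ^ 2 ≤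
        η ^ 2 * ∫ x, frobeniusNormSq (fderiv ℝ (curl (u t)) x) := fun t ht =>
    not_lt.1 (hsub ⟨hat₁.trans_le ht.1, ht.2⟩)
  exact hsing (hasSmoothExtensionPast_of_eventually_longitudinalFraction_le hν hT hC hη0 hηC ht₁ hsol hLH
    hdec hL hrate)

/-- **TARGET-SHAPED COROLLARY (longitudinal).** A classical Leray–Hopf rapidly-decaying-datum solution on `[0,T)`
that blows up at most at Type-I rate (`IsTypeIBlowup u T`, ANY constant) and whose longitudinal palinstrophy
fraction tends to zero — for every `η > 0`, eventually `∫‖Dω ω‖²/‖ω‖² ≤ η² ‖∇ω‖₂²` — extends smoothly past `T`: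
Type I is excluded for flows whose vortex lines straighten with `|ω|` uniform along them, in palinstrophy measure.
[folklore] -/
theorem hasSmoothExtensionPast_of_isTypeIBlowup_of_longitudinalFraction_tendsto (hν : 0 < ν) (hT : 0 < T)
    (hsol : IsClassicalNSSolutionOn (Ico 0 T) ν 0 u p) (hLH : IsLerayHopfOn T ν 0 (u 0) u)
    (hdec : HasRapidSpatialDecay (u 0)) (hI : IsTypeIBlowup u T)
    (hL : ∀ η : ℝ, 0 < η → ∀ᶠ t in 𝓝[<] T,
      ∫ x, ‖fderiv ℝ (curl (u t)) x (curl (u t) x)‖ ^ 2 / ‖curl (u t) x‖ ^ 2 ≤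
        η ^ 2 * ∫ x, frobeniusNormSq (fderiv ℝ (curl (u t)) x)) :
    HasSmoothExtensionPast ν 0 u T := by
  obtain ⟨C₀, hC₀⟩ := hI
  -- dimensionless rate `C = (|C₀| + 1)/√ν`
  have hsν : 0 < Real.sqrt ν := Real.sqrt_pos.2 hν
  set C : ℝ := (|C₀| + 1) / Real.sqrt ν with hCdef
  have hC : 0 < C := by positivity
  have hrate : ∀ᶠ t in 𝓝[<] T, ∀ x, Real.sqrt (T - t) * ‖u t x‖ ≤ C * Real.sqrt ν := by
    have hlt : ∀ᶠ t in 𝓝[<] T, t < T := eventually_nhdsWithin_of_forall fun t ht => ht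
    filter_upwards [hC₀, hlt] with t ht htT x
    have hst : 0 < Real.sqrt (T - t) := Real.sqrt_pos.2 (sub_pos.2 htT)
    have h1 : Real.sqrt (T - t) * ‖u t x‖ ≤ C₀ := by
      have := ht x
      rwa [le_div_iff₀ hst, mul_comm] at this
    have h2 : C * Real.sqrt ν = |C₀| + 1 := by rw [hCdef]; field_simp
    rw [h2]
    linarith [le_abs_self C₀]
  -- `η = 1/(2C)`
  set η : ℝ := 1 / (2 * C) with hηdef
  have hη : 0 < η := by positivity
  have hηC : η * C < 1 := by
    rw [hηdef]; field_simp; norm_num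
  obtain ⟨a, haT, hsub⟩ := mem_nhdsLT_iff_exists_Ioo_subset.1 (hL η hη)
  set t₁ : ℝ := (max a 0 + T) / 2 with ht₁def
  have hm : max a 0 < T := max_lt haT hT
  have ht₁ : t₁ ∈ Ico 0 T := by
    have := le_max_right a 0; rw [ht₁def]; constructor <;> linarith
  have hat₁ : a < t₁ := by
    have := le_max_left a 0; rw [ht₁def]; linarith
  exact hasSmoothExtensionPast_of_eventually_longitudinalFraction_le hν hT hC hη.le hηC ht₁ hsol hLH hdec
    (fun t ht => hsub ⟨hat₁.trans_le ht.1, ht.2⟩) hrate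

/-! ## The twist rung and its portrait -/

/-- **THE TWIST RUNG.** A classical Leray–Hopf rapidly-decaying-datum solution on `[0,T)` with eventual rate
`√(T−t)|u(t,x)| ≤ C√ν` whose twist fraction satisfies, on a final interval `[t₁,T)`,
`∫⟪ω, curl ω⟫²/‖ω‖² ≥ (1 − η²) ‖∇ω‖₂²` with `0 ≤ η` and `ηC < 1`, extends smoothly past `T`: palinstrophy that is
helical up to the fraction `η²` cannot sustain a Type-I(`C`) blow-up. [folklore] -/
theorem hasSmoothExtensionPast_of_eventually_twistFraction_ge {C η t₁ : ℝ} (hν : 0 < ν) (hT : 0 < T)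
    (hC : 0 < C) (hη0 : 0 ≤ η) (hηC : η * C < 1) (ht₁ : t₁ ∈ Ico 0 T)
    (hsol : IsClassicalNSSolutionOn (Ico 0 T) ν 0 u p) (hLH : IsLerayHopfOn T ν 0 (u 0) u)
    (hdec : HasRapidSpatialDecay (u 0))
    (hτ : ∀ t ∈ Ico t₁ T,
      (1 - η ^ 2) * ∫ x, frobeniusNormSq (fderiv ℝ (curl (u t)) x) ≤
        ∫ x, ⟪curl (u t) x, curl (curl (u t)) x⟫ ^ 2 / ‖curl (u t) x‖ ^ 2)
    (hrate : ∀ᶠ t in 𝓝[<] T, ∀ x, Real.sqrt (T - t) * ‖u t x‖ ≤ C * Real.sqrt ν) :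
    HasSmoothExtensionPast ν 0 u T := by
  refine rung_of_eventualDepletion hν hT hη0 hC hηC ht₁ hsol hLH hdec (fun t ht M hM => ?_) hrate
  have ht0 : t ∈ Ico 0 T := ⟨ht₁.1.trans ht.1, ht.2⟩
  have hM0 : 0 ≤ M := (norm_nonneg _).trans (hM 0)
  have h := transversalCurl_along_flow hν hT hsol hLH hdec t ht0 M hM
  have hle : (∫ x, frobeniusNormSq (fderiv ℝ (curl (u t)) x)) -
      ∫ x, ⟪curl (u t) x, curl (curl (u t)) x⟫ ^ 2 / ‖curl (u t) x‖ ^ 2 ≤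
        η ^ 2 * ∫ x, frobeniusNormSq (fderiv ℝ (curl (u t)) x) := by
    have := hτ t ht; linarith
  have hsq : Real.sqrt ((∫ x, frobeniusNormSq (fderiv ℝ (curl (u t)) x)) -
      ∫ x, ⟪curl (u t) x, curl (curl (u t)) x⟫ ^ 2 / ‖curl (u t) x‖ ^ 2) ≤
        η * Real.sqrt (∫ x, frobeniusNormSq (fderiv ℝ (curl (u t)) x)) := by
    rw [← Real.sqrt_sq hη0, ← Real.sqrt_mul (sq_nonneg _)]
    exact Real.sqrt_le_sqrt hle
  calc _ ≤ _ := h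
    _ ≤ M * Real.sqrt (∫ x, ‖curl (u t) x‖ ^ 2) *
          (η * Real.sqrt (∫ x, frobeniusNormSq (fderiv ℝ (curl (u t)) x))) :=
        mul_le_mul_of_nonneg_left hsq (by positivity)
    _ = _ := by ring

/-- **PORTRAIT: a Type-I blow-up cannot be fully helical.** If the classical Leray–Hopf rapidly-decaying-datum
solution has eventual rate `√(T−t)|u| ≤ C√ν` and does NOT extend past `T`, then for every `0 ≤ η` with `ηC < 1`,
FREQUENTLY as `t ↑ T`: `∫⟪ω, curl ω⟫²/‖ω‖² < (1 − η²)‖∇ω‖₂²` — i.e. `liminf_{t↑T} τ(t) ≤ 1 − C⁻²`: at least the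
fraction `C⁻²` of the palinstrophy is carried by `ξ × curl ω` (transversal magnitude gradient and curvature). [folklore] -/
theorem frequently_twistFraction_lt {C η : ℝ} (hν : 0 < ν) (hT : 0 < T) (hC : 0 < C) (hη0 : 0 ≤ η)
    (hηC : η * C < 1)
    (hsol : IsClassicalNSSolutionOn (Ico 0 T) ν 0 u p) (hLH : IsLerayHopfOn T ν 0 (u 0) u)
    (hdec : HasRapidSpatialDecay (u 0))
    (hrate : ∀ᶠ t in 𝓝[<] T, ∀ x, Real.sqrt (T - t) * ‖u t x‖ ≤ C * Real.sqrt ν)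
    (hsing : ¬ HasSmoothExtensionPast ν 0 u T) :
    ∃ᶠ t in 𝓝[<] T,
      ∫ x, ⟪curl (u t) x, curl (curl (u t)) x⟫ ^ 2 / ‖curl (u t) x‖ ^ 2 <
        (1 - η ^ 2) * ∫ x, frobeniusNormSq (fderiv ℝ (curl (u t)) x) := by
  by_contra h
  rw [not_frequently] at h
  obtain ⟨a, haT, hsub⟩ := mem_nhdsLT_iff_exists_Ioo_subset.1 h
  set t₁ : ℝ := (max a 0 + T) / 2 with ht₁def
  have hm : max a 0 < T := max_lt haT hT
  have ht₁ : t₁ ∈ Ico 0 T := by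
    have := le_max_right a 0; rw [ht₁def]; constructor <;> linarith
  have hat₁ : a < t₁ := by
    have := le_max_left a 0; rw [ht₁def]; linarith
  have hτ : ∀ t ∈ Ico t₁ T,
      (1 - η ^ 2) * ∫ x, frobeniusNormSq (fderiv ℝ (curl (u t)) x) ≤
        ∫ x, ⟪curl (u t) x, curl (curl (u t)) x⟫ ^ 2 / ‖curl (u t) x‖ ^ 2 := fun t ht =>
    not_lt.1 (hsub ⟨hat₁.trans_le ht.1, ht.2⟩)
  exact hsing (hasSmoothExtensionPast_of_eventually_twistFraction_ge hν hT hC hη0 hηC ht₁ hsol hLH hdec hτ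
    hrate)

/-- **TARGET-SHAPED COROLLARY (twist).** A classical Leray–Hopf rapidly-decaying-datum solution on `[0,T)` that blows
up at most at Type-I rate (`IsTypeIBlowup u T`, ANY constant) and whose twist fraction tends to one — for every
`η > 0`, eventually `∫⟪ω, curl ω⟫²/‖ω‖² ≥ (1 − η²)‖∇ω‖₂²` — extends smoothly past `T`. [folklore] -/
theorem hasSmoothExtensionPast_of_isTypeIBlowup_of_twistFraction_tendsto (hν : 0 < ν) (hT : 0 < T)
    (hsol : IsClassicalNSSolutionOn (Ico 0 T) ν 0 u p) (hLH : IsLerayHopfOn T ν 0 (u 0) u)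
    (hdec : HasRapidSpatialDecay (u 0)) (hI : IsTypeIBlowup u T)
    (hτ : ∀ η : ℝ, 0 < η → ∀ᶠ t in 𝓝[<] T,
      (1 - η ^ 2) * ∫ x, frobeniusNormSq (fderiv ℝ (curl (u t)) x) ≤
        ∫ x, ⟪curl (u t) x, curl (curl (u t)) x⟫ ^ 2 / ‖curl (u t) x‖ ^ 2) :
    HasSmoothExtensionPast ν 0 u T := by
  obtain ⟨C₀, hC₀⟩ := hI
  have hsν : 0 < Real.sqrt ν := Real.sqrt_pos.2 hν
  set C : ℝ := (|C₀| + 1) / Real.sqrt ν with hCdef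
  have hC : 0 < C := by positivity
  have hrate : ∀ᶠ t in 𝓝[<] T, ∀ x, Real.sqrt (T - t) * ‖u t x‖ ≤ C * Real.sqrt ν := by
    have hlt : ∀ᶠ t in 𝓝[<] T, t < T := eventually_nhdsWithin_of_forall fun t ht => ht
    filter_upwards [hC₀, hlt] with t ht htT x
    have hst : 0 < Real.sqrt (T - t) := Real.sqrt_pos.2 (sub_pos.2 htT)
    have h1 : Real.sqrt (T - t) * ‖u t x‖ ≤ C₀ := by
      have := ht x
      rwa [le_div_iff₀ hst, mul_comm] at this
    have h2 : C * Real.sqrt ν = |C₀| + 1 := by rw [hCdef]; field_simp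
    rw [h2]
    linarith [le_abs_self C₀]
  set η : ℝ := 1 / (2 * C) with hηdef
  have hη : 0 < η := by positivity
  have hηC : η * C < 1 := by
    rw [hηdef]; field_simp; norm_num
  obtain ⟨a, haT, hsub⟩ := mem_nhdsLT_iff_exists_Ioo_subset.1 (hτ η hη)
  set t₁ : ℝ := (max a 0 + T) / 2 with ht₁def
  have hm : max a 0 < T := max_lt haT hT
  have ht₁ : t₁ ∈ Ico 0 T := by
    have := le_max_right a 0; rw [ht₁def]; constructor <;> linarith
  have hat₁ : a < t₁ := by
    have := le_max_left a 0; rw [ht₁def]; linarith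
  exact hasSmoothExtensionPast_of_eventually_twistFraction_ge hν hT hC hη.le hηC ht₁ hsol hLH hdec
    (fun t ht => hsub ⟨hat₁.trans_le ht.1, ht.2⟩) hrate

end Channels

end Summit.NavierStokesRegularity.NavierStokesRegularity.Theorems.DepletionLadder

end
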